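import Summits.NavierStokesRegularity.FluidComputer.GateBudgetClockBand
import HarnessLib

/-!
# GateBudget part 100 — the swing band of a headline pulse and its climb dose (§276–§277)

Cell `pub-fluidc`, blueprint seat bp1 (gen 38, fourth item); namespace
`Summit.NavierStokesRegularity.FluidComputer.GateBudget`, knob family
`RotorKnob.rotorCircuit K M ε ρ` (modes `0 = a` carrier, `1 = b` clock, `2 = c` trigger,
`3 = d` transfer, `4 = ã` output) from `delayInit`, trigger primitive `C` (`C' = c`). Imports
part 73 (`GateBudgetClockBand`). HONEST FRAMING: a low prior, high value-of-information
experiment on Tao's machine paradigm; NOT a claim that NS blows up. Nothing here is about the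
Navier–Stokes equations.

THE POINT (SPEC-INPUT-bp1 §BV, the swing law; part 99 `GateBudgetSwingClock` is its clock
half). Part 73 §223 `pulse_clock_phases` splits a headline pulse at band times `t₁ < t₂` but
EXPORTS only what the crude ceiling of part 75 needed: the climb floor `b ≥ (31/32)θε` on
`[r, t₁]`, durations, edge triggers and the fall. The swing law needs the band ITSELF — that
`b` runs from `+(31/32)θε` at `t₁` to `-(31/32)θε` at `t₂` and stays in between (so that
part 99's angle laws apply on every sub-interval) — and it needs the DOSE PHASE AT BAND ENTRY
`Φ₁ = (C(t₁) - C(r))/ρ²`: the swing's transfer integrand is `sin²(α + ψ)/sin α` with the phase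
offset `ψ = Φ₁ + φ₀ - α₁`, and only a pinned `ψ` beats the crude price (SPEC-INPUT §BV(4): the
bound uniform in `ψ` is `3.3 ≈ 4.16/θ`). The pin comes from the CLIMB: while `b ∈ [β, B]` the
trigger obeys `μβc ≤ c' - ρ²e^{-M}a² ≤ μBc`, so `μβ·ΔC ≤ Δc ≤ μB·ΔC + ρ²e^{-M}Δt`: the dose
consumed by the climb is `Δc/(μθε)` up to `10⁻⁴`, i.e. `Φ₁ ≈ c(t₁)/(μρ²θε) = k·sin α₁`
(`≈ 0.248k` against `α₁ = arccos(31/32) = 0.2507`; at `k = 1` the offset is `|ψ| ≲ 10⁻²`).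

* §276 `clock_antitone_of_trigger` (any member, `ε, M > 0`): where `c² ≥ ε²/M` the clock
  FALLS (`b' = εa² - μc² ≤ ε - ε = 0`); `climb_dose_upper` / `climb_dose_lower` (any member):
  `b ≥ β`, `c ≥ 0` on `[r, t]` ⇒ `ε⁻¹Mβ·(C(t) - C(r)) ≤ c(t) - c(r)`; `b ≤ B`, `c ≥ 0` ⇒
  `c(t) - c(r) ≤ ε⁻¹MB·(C(t) - C(r)) + ρ²e^{-M}(t - r)`.
* §277 `pulse_swing_band`, THE SWING BAND of a headline pulse (hypotheses of §223 VERBATIM):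
  band times `r < t₁ < t₂ ≤ T'` with `b(t₁) = (31/32)θε`, `b(t₂) = -(31/32)θε`;
  CLIMB `(31/32)θε ≤ b ≤ (1 + 10⁻⁴)θε` on `[r, t₁]`, lasting
  `≤ 32(log c(t₁) - log c(r))/(31θK¹⁰)`, with the DOSE
  `(31/32)θK¹⁰·(C(t₁) - C(r)) ≤ c(t₁) - c(r) ≤ (1 + 10⁻⁴)θK¹⁰·(C(t₁) - C(r))
  + ρ²e^{-K¹⁰}(t₁ - r)` (`μ·b = ε⁻¹K¹⁰·θε`: no `ε` left); BAND `-(31/32)θε ≤ b ≤ (31/32)θε`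
  on `[t₁, t₂]` (the clock falls monotonically across it); FALL `b ≤ -(15/16)θε` on
  `[t₂, T']`; the ring `θ²ε² - ε²/10⁶ ≤ b² + c² ≤ θ²ε² + 2ε²/10⁶` on `[r, T']`; edge
  triggers `c(t₁)², c(t₂)² ≤ θ²ε²/16`.

HONEST LIMITS. (i) A re-export: the construction is part 73 §223's (same hit times, same
charging and ring estimates) with three additions — the monotone fall of `b` across the band,
the upper edge of the climb, the two dose inequalities; nothing about the rotor or the output;
(ii) the dose inequalities are stated in `c` and `C`, not in the angle: turning them into
`|Φ₁ - α₁| ≤ 10⁻²` needs the edge trigger window `Q - b₁² ≤ c(t₁)² ≤ Q₁ - b₁²` (from the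
exported ring) and is left to part 101; (iii) constants `31/32`, `15/16`, `10⁻⁴`, `10⁻⁶` as in
part 73, not optimised; (iv) nothing about Navier–Stokes.
[cite: Tao2016AveragedNS, §5.5 Theorem 5.3, (5.5), (b-eq), (c-eq), (energy-con), (tcable)]
-/

noncomputable section

namespace Summit.NavierStokesRegularity.FluidComputer.GateBudget

open Real Set Filter Topology
open Literature.Analysis.FluidPDE.Tao2016AveragedNS

variable {K M ε ρ : ℝ} {X : ℝ → Fin 5 → ℝ} {C : ℝ → ℝ}

/-! ## §276 The clock falls where the trigger is live; the climb dose -/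

/-- §276 (any member from `delayInit`, `ε, M > 0`): on an interval where `c² ≥ ε²/M` the clock
is non-increasing (`b' = εa² - ε⁻¹Mc² ≤ ε·1 - ε = 0`). [derived: this file] -/
theorem clock_antitone_of_trigger
    (hX : ∀ t, HasDerivAt X (RotorKnob.rotorCircuit K M ε ρ (X t)) t) (h0 : X 0 = delayInit)
    (hε : 0 < ε) (hM : 0 < M) {s t : ℝ}
    (hc : ∀ u ∈ Icc s t, ε ^ 2 / M ≤ X u 2 ^ 2) : AntitoneOn (fun u => X u 1) (Icc s t) := by
  have hanti := Thm53.antitoneOn_sub_of_deriv_le (f := fun u => X u 1)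
    (f' := fun u => ε * X u 0 ^ 2 - ε⁻¹ * M * X u 2 ^ 2) (Φ := fun _ => (0 : ℝ))
    (φ := fun _ => (0 : ℝ)) (convex_Icc s t) (fun u _ => RotorKnob.hasDerivAt_b hX u)
    (fun u _ => hasDerivAt_const u 0)
    (fun u hu => by
      have ha := RotorKnob.traj_sq_le_one hX h0 u 0
      have h1 : ε * X u 0 ^ 2 ≤ ε * 1 := mul_le_mul_of_nonneg_left ha hε.le
      have h2 : ε⁻¹ * M * (ε ^ 2 / M) ≤ ε⁻¹ * M * X u 2 ^ 2 :=
        mul_le_mul_of_nonneg_left (hc u hu) (by positivity)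
      have e1 : ε⁻¹ * M * (ε ^ 2 / M) = ε := by
        field_simp
      show ε * X u 0 ^ 2 - ε⁻¹ * M * X u 2 ^ 2 ≤ 0
      linarith only [h1, h2, e1])
  simpa using hanti

/-- §276 THE CLIMB DOSE FROM ABOVE (any member, `ε > 0`, `M ≥ 0`): if `b ≥ β` and `c ≥ 0` on
`[r, t]` then `ε⁻¹Mβ·(C(t) - C(r)) ≤ c(t) - c(r)` (`c' = ρ²e^{-M}a² + ε⁻¹Mbc ≥ ε⁻¹Mβc`).
[derived: this file] -/
theorem climb_dose_upper (hX : ∀ t, HasDerivAt X (RotorKnob.rotorCircuit K M ε ρ (X t)) t)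
    (hC : ∀ t, HasDerivAt C (X t 2) t) (hε : 0 < ε) (hM : 0 ≤ M) {r t β : ℝ} (hrt : r ≤ t)
    (hb : ∀ u ∈ Icc r t, β ≤ X u 1) (hc : ∀ u ∈ Icc r t, 0 ≤ X u 2) :
    ε⁻¹ * M * β * (C t - C r) ≤ X t 2 - X r 2 := by
  have hμ : 0 ≤ ε⁻¹ * M := by positivity
  have hmono := Thm53.monotoneOn_sub_of_le_deriv (f := fun u => X u 2)
    (f' := fun u => ρ ^ 2 * exp (-M) * X u 0 ^ 2 + ε⁻¹ * M * X u 1 * X u 2)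
    (Φ := fun u => ε⁻¹ * M * β * C u) (φ := fun u => ε⁻¹ * M * β * X u 2) (convex_Icc r t)
    (fun u _ => RotorKnob.hasDerivAt_c hX u) (fun u _ => (hC u).const_mul (ε⁻¹ * M * β))
    (fun u hu => by
      have h1 : 0 ≤ ρ ^ 2 * exp (-M) * X u 0 ^ 2 := by positivity
      have h2 : ε⁻¹ * M * β * X u 2 ≤ ε⁻¹ * M * X u 1 * X u 2 := by
        have := mul_le_mul_of_nonneg_right (hb u hu) (hc u hu)
        nlinarith only [this, hμ]
      show ε⁻¹ * M * β * X u 2 ≤ ρ ^ 2 * exp (-M) * X u 0 ^ 2 + ε⁻¹ * M * X u 1 * X u 2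
      linarith only [h1, h2])
  have h := hmono (left_mem_Icc.2 hrt) (right_mem_Icc.2 hrt) hrt
  dsimp only at h
  have e : ε⁻¹ * M * β * (C t - C r) = ε⁻¹ * M * β * C t - ε⁻¹ * M * β * C r := by ring
  linarith only [h, e]

/-- §276 THE CLIMB DOSE FROM BELOW (any member from `delayInit`, `ε > 0`, `M ≥ 0`): if `b ≤ B`
and `c ≥ 0` on `[r, t]` then `c(t) - c(r) ≤ ε⁻¹MB·(C(t) - C(r)) + ρ²e^{-M}(t - r)`
(`a² ≤ 1`). [derived: this file] -/
theorem climb_dose_lower (hX : ∀ t, HasDerivAt X (RotorKnob.rotorCircuit K M ε ρ (X t)) t)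
    (h0 : X 0 = delayInit) (hC : ∀ t, HasDerivAt C (X t 2) t) (hε : 0 < ε) (hM : 0 ≤ M)
    {r t B : ℝ} (hrt : r ≤ t) (hb : ∀ u ∈ Icc r t, X u 1 ≤ B) (hc : ∀ u ∈ Icc r t, 0 ≤ X u 2) :
    X t 2 - X r 2 ≤ ε⁻¹ * M * B * (C t - C r) + ρ ^ 2 * exp (-M) * (t - r) := by
  have hμ : 0 ≤ ε⁻¹ * M := by positivity
  have hanti := Thm53.antitoneOn_sub_of_deriv_le (f := fun u => X u 2)
    (f' := fun u => ρ ^ 2 * exp (-M) * X u 0 ^ 2 + ε⁻¹ * M * X u 1 * X u 2)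
    (Φ := fun u => ε⁻¹ * M * B * C u + ρ ^ 2 * exp (-M) * u)
    (φ := fun u => ε⁻¹ * M * B * X u 2 + ρ ^ 2 * exp (-M)) (convex_Icc r t)
    (fun u _ => RotorKnob.hasDerivAt_c hX u)
    (fun u _ => (((hC u).const_mul (ε⁻¹ * M * B)).add
      ((hasDerivAt_id' u).const_mul (ρ ^ 2 * exp (-M)))).congr_deriv (by ring))
    (fun u hu => by
      have ha := RotorKnob.traj_sq_le_one hX h0 u 0
      have h1 : ρ ^ 2 * exp (-M) * X u 0 ^ 2 ≤ ρ ^ 2 * exp (-M) * 1 :=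
        mul_le_mul_of_nonneg_left ha (by positivity)
      have h2 : ε⁻¹ * M * X u 1 * X u 2 ≤ ε⁻¹ * M * B * X u 2 := by
        have := mul_le_mul_of_nonneg_right (hb u hu) (hc u hu)
        nlinarith only [this, hμ]
      show ρ ^ 2 * exp (-M) * X u 0 ^ 2 + ε⁻¹ * M * X u 1 * X u 2
          ≤ ε⁻¹ * M * B * X u 2 + ρ ^ 2 * exp (-M)
      linarith only [h1, h2])
  have h := hanti (left_mem_Icc.2 hrt) (right_mem_Icc.2 hrt) hrt
  dsimp only at h
  have e : ε⁻¹ * M * B * (C t - C r) = ε⁻¹ * M * B * C t - ε⁻¹ * M * B * C r := by ring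
  linarith only [h, e]

/-! ## §277 The swing band of a headline pulse -/

/-- §277 THE SWING BAND (headline member `M = K¹⁰`, `K ≥ 16`, `ε, ρ > 0`, `K¹⁰ρ² ≤ 2ε`; the
hypotheses of part 73 §223 verbatim: a pulse `[r, T']`, `T' - r ≤ 242/K⁹`, entered at
`b(r) = θε`, `c(r) = ρ²/K⁹`, `θ ≥ 5/4`, kept ring `|b² + c² - (b(r)² + c(r)²)| ≤ 10⁻⁶ε²` and
`c > 0` on `[r, T']`, left with `b(T') ≤ -(31/32)θε`; plus a trigger primitive `C`). Band
times `r < t₁ < t₂ ≤ T'` with: `b(t₁) = (31/32)θε`, `b(t₂) = -(31/32)θε`; CLIMB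
`(31/32)θε ≤ b ≤ (1 + 10⁻⁴)θε` on `[r, t₁]`; BAND `|b| ≤ (31/32)θε` on `[t₁, t₂]`; FALL
`b ≤ -(15/16)θε` on `[t₂, T']`; RING `θ²ε² - 10⁻⁶ε² ≤ b² + c² ≤ θ²ε² + 2·10⁻⁶ε²` on
`[r, T']`; EDGES `c(t₁)², c(t₂)² ≤ θ²ε²/16`; CLIMB DURATION
`t₁ - r ≤ 32(log c(t₁) - log c(r))/(31θK¹⁰)`; CLIMB DOSE
`(31/32)θK¹⁰·(C(t₁) - C(r)) ≤ c(t₁) - c(r) ≤ (1 + 10⁻⁴)θK¹⁰·(C(t₁) - C(r))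
+ ρ²e^{-K¹⁰}(t₁ - r)`. [derived: part 73 §220–§223; this file §276] -/
theorem pulse_swing_band
    (hX : ∀ t, HasDerivAt X (RotorKnob.rotorCircuit K (K ^ 10) ε ρ (X t)) t)
    (h0 : X 0 = delayInit) (hC : ∀ t, HasDerivAt C (X t 2) t) (hK : 16 ≤ K) (hε : 0 < ε)
    (hρ : 0 < ρ) (hhi : K ^ 10 * ρ ^ 2 ≤ 2 * ε) {r T' θ : ℝ} (hrT : r ≤ T')
    (hτ : T' - r ≤ 242 / K ^ 9) (hθ1 : 5 / 4 ≤ θ) (hbr : X r 1 = θ * ε)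
    (hcr : X r 2 = ρ ^ 2 / K ^ 9)
    (hkept : ∀ t ∈ Icc r T', |X t 1 ^ 2 + X t 2 ^ 2 - (X r 1 ^ 2 + X r 2 ^ 2)| ≤ ε ^ 2 / 10 ^ 6)
    (hpos : ∀ t ∈ Icc r T', 0 < X t 2) (hbT : X T' 1 ≤ -(31 / 32 * θ * ε)) :
    ∃ t₁ t₂ : ℝ, r < t₁ ∧ t₁ < t₂ ∧ t₂ ≤ T' ∧
      X t₁ 1 = 31 / 32 * θ * ε ∧ X t₂ 1 = -(31 / 32 * θ * ε) ∧
      (∀ t ∈ Icc r t₁, 31 / 32 * θ * ε ≤ X t 1 ∧ X t 1 ≤ (1 + 1 / 10 ^ 4) * (θ * ε)) ∧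
      (∀ t ∈ Icc t₁ t₂, -(31 / 32 * θ * ε) ≤ X t 1 ∧ X t 1 ≤ 31 / 32 * θ * ε) ∧
      (∀ t ∈ Icc t₂ T', X t 1 ≤ -(15 / 16 * θ * ε)) ∧
      (∀ t ∈ Icc r T', θ ^ 2 * ε ^ 2 - ε ^ 2 / 10 ^ 6 ≤ X t 1 ^ 2 + X t 2 ^ 2 ∧
        X t 1 ^ 2 + X t 2 ^ 2 ≤ θ ^ 2 * ε ^ 2 + 2 * ε ^ 2 / 10 ^ 6) ∧
      X t₁ 2 ^ 2 ≤ θ ^ 2 * ε ^ 2 / 16 ∧ X t₂ 2 ^ 2 ≤ θ ^ 2 * ε ^ 2 / 16 ∧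
      t₁ - r ≤ 32 * (log (X t₁ 2) - log (X r 2)) / (31 * θ * K ^ 10) ∧
      31 / 32 * θ * K ^ 10 * (C t₁ - C r) ≤ X t₁ 2 - X r 2 ∧
      X t₁ 2 - X r 2 ≤ (1 + 1 / 10 ^ 4) * θ * K ^ 10 * (C t₁ - C r)
        + ρ ^ 2 * exp (-K ^ 10) * (t₁ - r) := by
  have hK0 : (0 : ℝ) < K := by linarith
  have hK1 : (1 : ℝ) ≤ K := by linarith
  have hθ0 : 0 < θ := by linarith
  have hθε : 0 < θ * ε := mul_pos hθ0 hε
  have hθε2 : 25 / 16 * ε ^ 2 ≤ (θ * ε) ^ 2 := by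
    nlinarith only [mul_le_mul_of_nonneg_right hθ1 hε.le, hε]
  obtain ⟨b₁, hb₁⟩ : ∃ b₁ : ℝ, b₁ = 31 / 32 * θ * ε := ⟨_, rfl⟩
  have hb₁0 : 0 < b₁ := by rw [hb₁]; positivity
  have hcont : Continuous fun s => X s 1 := RotorKnob.continuous_traj hX 1
  -- numerics: `K⁹ ≥ 2³⁶`, `K¹⁰ ≥ 2⁴⁰`, so `242ε/K⁹ ≤ θε/10⁴` and `ρ²/K⁹ ≤ ε/10³`
  have hK9 : (2 : ℝ) ^ 36 ≤ K ^ 9 := by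
    calc (2 : ℝ) ^ 36 = 16 ^ 9 := by norm_num
      _ ≤ K ^ 9 := pow_le_pow_left₀ (by norm_num) hK 9
  have hK10 : (2 : ℝ) ^ 40 ≤ K ^ 10 := by
    calc (2 : ℝ) ^ 40 = 16 ^ 10 := by norm_num
      _ ≤ K ^ 10 := pow_le_pow_left₀ (by norm_num) hK 10
  have hK10pos : (0 : ℝ) < K ^ 10 := by positivity
  have hτε : ε * (T' - r) ≤ θ * ε / 10 ^ 4 := by
    have e1 : ε * (T' - r) ≤ ε * (242 / K ^ 9) := mul_le_mul_of_nonneg_left hτ hε.le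
    have e2 : 242 / K ^ 9 ≤ 242 / 2 ^ 36 :=
      div_le_div_of_nonneg_left (by norm_num) (by positivity) hK9
    have e3 : ε * (242 / 2 ^ 36) ≤ θ * ε / 10 ^ 4 := by
      rw [le_div_iff₀ (by norm_num : (0 : ℝ) < 10 ^ 4)]
      nlinarith only [hε, hθ1]
    nlinarith only [e1, e2, e3, hε]
  have hcr2 : X r 2 ^ 2 ≤ ε ^ 2 / 10 ^ 6 := by
    have hρε : ρ ^ 2 ≤ 2 * ε / K ^ 10 := by
      rw [le_div_iff₀ hK10pos]
      linarith only [hhi]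
    have e1 : ρ ^ 2 / K ^ 9 ≤ ρ ^ 2 := div_le_self (by positivity) (one_le_pow₀ hK1)
    have e3 : 2 * ε / K ^ 10 ≤ 2 * ε / 2 ^ 40 :=
      div_le_div_of_nonneg_left (by positivity) (by positivity) hK10
    have e4 : 2 * ε / 2 ^ 40 ≤ ε / 10 ^ 3 := by
      rw [div_le_div_iff₀ (by positivity) (by positivity)]
      linarith only [hε]
    have hcr1 : ρ ^ 2 / K ^ 9 ≤ ε / 10 ^ 3 := by linarith only [e1, hρε, e3, e4]
    rw [hcr]
    calc (ρ ^ 2 / K ^ 9) ^ 2 ≤ (ε / 10 ^ 3) ^ 2 := pow_le_pow_left₀ (by positivity) hcr1 2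
      _ = ε ^ 2 / 10 ^ 6 := by rw [div_pow]; norm_num
  -- the ring from above and below
  have hring : ∀ t ∈ Icc r T', θ ^ 2 * ε ^ 2 - ε ^ 2 / 10 ^ 6 ≤ X t 1 ^ 2 + X t 2 ^ 2 ∧
      X t 1 ^ 2 + X t 2 ^ 2 ≤ θ ^ 2 * ε ^ 2 + 2 * ε ^ 2 / 10 ^ 6 := by
    intro t ht
    have h := abs_le.1 (hkept t ht)
    rw [hbr] at h
    constructor
    · nlinarith only [h.1, sq_nonneg (X r 2)]
    · nlinarith only [h.2, hcr2]
  -- trigger at a band edge: `b² ≥ b₁²` ⇒ `c² ≤ θ²ε²/16`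
  have hedge : ∀ t ∈ Icc r T', b₁ ^ 2 ≤ X t 1 ^ 2 → X t 2 ^ 2 ≤ θ ^ 2 * ε ^ 2 / 16 := by
    intro t ht hb2
    have h := (hring t ht).2
    rw [hb₁] at hb2
    nlinarith only [h, hb2, hθε2]
  -- `r < T'`
  have hrT' : r < T' := by
    rcases hrT.lt_or_eq with h | h
    · exact h
    · exfalso
      rw [← h, hbr] at hbT
      nlinarith only [hbT, hθε]
  -- (1) the first band time `t₁`: first hit of `b = b₁` from above
  obtain ⟨τ₁, hτ₁0, hτ₁T, hge₁, hhit₁⟩ := Thm53.exists_hitTime (u := fun s => -X (r + s) 1)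
    (θ := -b₁) (T := T' - r) ((hcont.comp (continuous_const.add continuous_id)).neg)
    (by linarith only [hrT']) (by
      show -X (r + 0) 1 < -b₁
      rw [add_zero, hbr, hb₁]; nlinarith only [hθε])
  have hτ₁lt : τ₁ < T' - r := by
    rcases hτ₁T.lt_or_eq with h | h
    · exact h
    · exfalso
      have := hge₁ τ₁ hτ₁0.le le_rfl
      rw [h, show r + (T' - r) = T' by ring] at this
      rw [hb₁] at this
      nlinarith only [this, hbT, hθε]
  have hbt₁ : X (r + τ₁) 1 = b₁ := by
    have := hhit₁ hτ₁lt
    linarith only [this]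
  obtain ⟨t₁, ht₁⟩ : ∃ t₁ : ℝ, t₁ = r + τ₁ := ⟨_, rfl⟩
  rw [← ht₁] at hbt₁
  have hrt₁ : r < t₁ := by rw [ht₁]; linarith only [hτ₁0]
  have ht₁T : t₁ < T' := by rw [ht₁]; linarith only [hτ₁lt]
  have hclimb : ∀ t ∈ Icc r t₁, b₁ ≤ X t 1 := by
    intro t ht
    have := hge₁ (t - r) (by linarith only [ht.1]) (by rw [ht₁] at ht; linarith only [ht.2])
    simp only [add_sub_cancel] at this
    linarith only [this]
  -- (2) the second band time `t₂`: first hit of `b = -b₁` after `t₁`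
  obtain ⟨τ₂, hτ₂0, hτ₂T, hge₂, hhit₂⟩ := Thm53.exists_hitTime (u := fun s => -X (t₁ + s) 1)
    (θ := b₁) (T := T' - t₁) ((hcont.comp (continuous_const.add continuous_id)).neg)
    (by linarith only [ht₁T]) (by
      show -X (t₁ + 0) 1 < b₁
      rw [add_zero, hbt₁]; linarith only [hb₁0])
  obtain ⟨t₂, ht₂⟩ : ∃ t₂ : ℝ, t₂ = t₁ + τ₂ := ⟨_, rfl⟩
  have ht₁t₂ : t₁ < t₂ := by rw [ht₂]; linarith only [hτ₂0]
  have ht₂T : t₂ ≤ T' := by rw [ht₂]; linarith only [hτ₂T]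
  have hlow₂ : ∀ t ∈ Icc t₁ t₂, -b₁ ≤ X t 1 := by
    intro t ht
    have := hge₂ (t - t₁) (by linarith only [ht.1]) (by rw [ht₂] at ht; linarith only [ht.2])
    simp only [add_sub_cancel] at this
    linarith only [this]
  have hbt₂ : X t₂ 1 = -b₁ := by
    rcases hτ₂T.lt_or_eq with h | h
    · have := hhit₂ h
      rw [ht₂]; linarith only [this]
    · have e : t₂ = T' := by rw [ht₂, h]; ring
      have h1 := hlow₂ t₂ ⟨ht₁t₂.le, le_rfl⟩
      rw [e] at h1 ⊢
      rw [hb₁] at h1 ⊢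
      linarith only [h1, hbT]
  -- (3) the clock above: charging at rate `≤ ε` from `r`, from `t₁` and from `t₂`
  have hup₀ : ∀ t ∈ Icc r t₁, X t 1 ≤ (1 + 1 / 10 ^ 4) * (θ * ε) := by
    intro t ht
    have h := clock_charge_le hX h0 hε.le (by positivity) ht.1
    rw [hbr] at h
    have : ε * (t - r) ≤ ε * (T' - r) :=
      mul_le_mul_of_nonneg_left (by linarith only [ht.2, ht₁T]) hε.le
    linarith only [h, this, hτε]
  have hup₁ : ∀ t ∈ Icc t₁ T', X t 1 ≤ b₁ + θ * ε / 10 ^ 4 := by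
    intro t ht
    have h := clock_charge_le hX h0 hε.le (by positivity) ht.1
    rw [hbt₁] at h
    have : ε * (t - t₁) ≤ ε * (T' - r) :=
      mul_le_mul_of_nonneg_left (by linarith only [ht.2, hrt₁]) hε.le
    linarith only [h, this, hτε]
  have hfall : ∀ t ∈ Icc t₂ T', X t 1 ≤ -(15 / 16 * θ * ε) := by
    intro t ht
    have h := clock_charge_le hX h0 hε.le (by positivity) ht.1
    rw [hbt₂, hb₁] at h
    have : ε * (t - t₂) ≤ ε * (T' - r) :=
      mul_le_mul_of_nonneg_left (by linarith only [ht.2, ht₁t₂, hrt₁]) hε.le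
    nlinarith only [h, this, hτε, hθε]
  -- (4) the band: there `c² ≥ θ²ε²(1 - 10⁻⁶ - (31/32 + 10⁻⁴)²) ≥ ε²/K¹⁰`, so `b` falls
  have hlive : ∀ u ∈ Icc t₁ t₂, ε ^ 2 / K ^ 10 ≤ X u 2 ^ 2 := by
    intro u hu
    have h1 := hlow₂ u hu
    have h2 := hup₁ u ⟨hu.1, hu.2.trans ht₂T⟩
    have h3 := (hring u ⟨hrt₁.le.trans hu.1, hu.2.trans ht₂T⟩).1
    have hb2 : X u 1 ^ 2 ≤ (b₁ + θ * ε / 10 ^ 4) ^ 2 := by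
      have hlt1 : -(b₁ + θ * ε / 10 ^ 4) ≤ X u 1 := by linarith only [h1, hθε]
      exact sq_le_sq' hlt1 h2
    have e1 : ε ^ 2 / K ^ 10 ≤ ε ^ 2 / 2 ^ 40 :=
      div_le_div_of_nonneg_left (by positivity) (by positivity) hK10
    rw [hb₁] at hb2
    nlinarith only [h3, hb2, e1, hθε2, sq_nonneg ε]
  have hmono := clock_antitone_of_trigger hX h0 hε hK10pos hlive
  have hband : ∀ t ∈ Icc t₁ t₂, -(31 / 32 * θ * ε) ≤ X t 1 ∧ X t 1 ≤ 31 / 32 * θ * ε := by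
    intro t ht
    refine ⟨by rw [← hb₁]; exact hlow₂ t ht, ?_⟩
    rw [← hb₁, ← hbt₁]
    exact hmono (left_mem_Icc.2 ht₁t₂.le) ht ht.1
  -- (5) the climb duration from §221 and the climb dose from §276
  have hpos₁ : ∀ u ∈ Icc r t₁, 0 < X u 2 := fun u hu => hpos u ⟨hu.1, hu.2.trans ht₁T.le⟩
  have hclimbτ : t₁ - r ≤ 32 * (log (X t₁ 2) - log (X r 2)) / (31 * θ * K ^ 10) := by
    have h := clock_rise_exp hX hε (by positivity) hrt₁.le hclimb hpos₁
    rw [le_div_iff₀ (by positivity)]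
    have e : ε⁻¹ * K ^ 10 * b₁ = 31 / 32 * θ * K ^ 10 := by
      rw [hb₁]; field_simp
    rw [e] at h
    nlinarith only [h, hθ0, hK10pos]
  have hdose₁ := climb_dose_upper hX hC hε hK10pos.le hrt₁.le hclimb
    (fun u hu => (hpos₁ u hu).le)
  have hdose₂ := climb_dose_lower hX h0 hC hε hK10pos.le hrt₁.le hup₀
    (fun u hu => (hpos₁ u hu).le)
  have hεε : ε⁻¹ * ε = 1 := inv_mul_cancel₀ hε.ne'
  have e1 : ε⁻¹ * K ^ 10 * b₁ = 31 / 32 * θ * K ^ 10 := by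
    calc ε⁻¹ * K ^ 10 * b₁ = 31 / 32 * θ * K ^ 10 * (ε⁻¹ * ε) := by rw [hb₁]; ring
      _ = 31 / 32 * θ * K ^ 10 := by rw [hεε, mul_one]
  have e2 : ε⁻¹ * K ^ 10 * ((1 + 1 / 10 ^ 4) * (θ * ε)) = (1 + 1 / 10 ^ 4) * θ * K ^ 10 := by
    calc ε⁻¹ * K ^ 10 * ((1 + 1 / 10 ^ 4) * (θ * ε))
          = (1 + 1 / 10 ^ 4) * θ * K ^ 10 * (ε⁻¹ * ε) := by ring
      _ = (1 + 1 / 10 ^ 4) * θ * K ^ 10 := by rw [hεε, mul_one]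
  rw [e1] at hdose₁
  rw [e2] at hdose₂
  refine ⟨t₁, t₂, hrt₁, ht₁t₂, ht₂T, by rw [hbt₁, hb₁], by rw [hbt₂, hb₁], ?_, hband, hfall,
    hring, ?_, ?_, hclimbτ, hdose₁, hdose₂⟩
  · intro t ht; exact ⟨by rw [← hb₁]; exact hclimb t ht, hup₀ t ht⟩
  · exact hedge t₁ ⟨hrt₁.le, ht₁T.le⟩ (by rw [hbt₁])
  · exact hedge t₂ ⟨hrt₁.le.trans ht₁t₂.le, ht₂T⟩ (by rw [hbt₂, neg_sq])

end Summit.NavierStokesRegularity.FluidComputer.GateBudget
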